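import Summits.AtomisticToContinuum.Crystallization.Theorems.GappedShellCensusCleanLimitsHaveWindowsInplaneGain5
import Summits.AtomisticToContinuum.Crystallization.Theorems.GappedShellCensusCleanLimitsHaveWindowsInplaneGain12

/-!
# `CleanLimitsHaveWindows` (stmt-AtomisticToContinuum-15932), line `Sketch`, stub `stub_inplaneGain`, helper 13:
# the layers of the expansion (lower sliver)

Support file for the certified in-plane gain, expansion `λ = 201/200` on `a ∈ [23/25, 191/200]`: the analogue of
helper 12. For the layer-wise differences `d(m') = Φ(a, z m' - z m, δ) - Φ(λa, z' m' - z' m, δ)`: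

* `ig_far_geom_L`: squared heights of a layer at distance `k` lie in `[k² D₁, k² D₂]`, the competitor's in
  `[k² D₁', H²]` with `H² - H'² ≥ β k²` (helper 3, the heights shrink);
* `ig_far_bound_L1`: `d(m') ≥ -igEllL1 k` for `2 ≤ k ≤ 7` and `d(m') ≥ -(3/25)/k⁴` for `k ≥ 8`;
* `ig_adj_bound_L`: `d(m ± 1) ≥ igAdjSumL A₁ A₂ 6`; `ig_in_bound_L`: `Φ₀(a) - Φ₀(λa) ≥ 6 (E(A₂) - E(ΛA₂)) +
  igInSumL A₁ A₂ 6`.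
-/

noncomputable section

namespace Summit.AtomisticToContinuum.Crystallization.Theorems.CleanHull

open Summit.AtomisticToContinuum.Crystallization.Theorems.LayeredHull
open Literature.MathematicalPhysics.StatisticalMechanics Finset

/-! ## Far layers: geometry -/

/-- **Geometry of a far layer under the expansion.** [folklore] -/
theorem ig_far_geom_L {a A₁ A₂ D₁ D₂ Dp d₂ e₁ β : ℝ} (z z' : ℤ → ℝ) (h1 : A₁ ≤ a ^ 2) (h2 : a ^ 2 ≤ A₂)
    (hD₁ : D₁ ≤ 81 / 100 - A₂ / 3) (hD₂ : 2601 / 2500 - A₁ / 3 ≤ D₂) (hD₁0 : 0 ≤ D₁) (hD₂0 : 0 ≤ D₂)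
    (hDp : Dp ≤ D₁ - 401 / 40000 * A₂ / 3) (hDp0 : 0 ≤ Dp) (he₁ : 0 < e₁) (he₁Dp : e₁ ^ 2 ≤ Dp)
    (hd₂ : D₂ ≤ d₂ ^ 2) (hd₂0 : 0 ≤ d₂) (hβ : β ≤ 401 / 40000 * A₁ / 3 * e₁ / d₂)
    (hband : ∀ m : ℤ, (9 / 10 : ℝ) ^ 2 ≤ a ^ 2 / 3 + (z (m + 1) - z m) ^ 2 ∧
      a ^ 2 / 3 + (z (m + 1) - z m) ^ 2 ≤ (51 / 50 : ℝ) ^ 2)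
    (hpos : ∀ m : ℤ, 0 < z (m + 1) - z m)
    (hz' : ∀ m : ℤ, (z' (m + 1) - z' m) ^ 2 = (z (m + 1) - z m) ^ 2 + a ^ 2 * (1 - (201 / 200 : ℝ) ^ 2) / 3)
    (hpos' : ∀ m : ℤ, 0 < z' (m + 1) - z' m) (m m' : ℤ) :
    ((m' - m).natAbs : ℝ) ^ 2 * D₁ ≤ (z m' - z m) ^ 2 ∧ (z m' - z m) ^ 2 ≤ ((m' - m).natAbs : ℝ) ^ 2 * D₂ ∧
      ((m' - m).natAbs : ℝ) ^ 2 * Dp ≤ (z' m' - z' m) ^ 2 ∧ (z' m' - z' m) ^ 2 ≤ (z m' - z m) ^ 2 ∧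
        β * ((m' - m).natAbs : ℝ) ^ 2 ≤ (z m' - z m) ^ 2 - (z' m' - z' m) ^ 2 := by
  set k := (m' - m).natAbs with hk
  set n := min m m' with hn
  have hA₂ : 0 ≤ A₂ := le_trans (sq_nonneg a) h2
  have hincr := fun j => ig_incr_bounds (d₁ := Real.sqrt D₁) h1 h2 (hband j) (hpos j) hD₁ hD₂
    (by rw [Real.sq_sqrt hD₁0]) hd₂ hd₂0
  set θ := a ^ 2 * ((201 / 200 : ℝ) ^ 2 - 1) / 3 with hθ
  have hθ0 : 0 ≤ θ := by rw [hθ]; positivity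
  have hθhi : θ ≤ 401 / 40000 * A₂ / 3 := by rw [hθ]; nlinarith
  have hθlo : 401 / 40000 * A₁ / 3 ≤ θ := by rw [hθ]; nlinarith
  have hsq : ∀ j : ℤ, (z' (j + 1) - z' j) ^ 2 = (z (j + 1) - z j) ^ 2 - θ := fun j => by rw [hz' j, hθ]; ring
  -- the competitor increments
  have hincr' : ∀ j : ℤ, Real.sqrt Dp ≤ z' (j + 1) - z' j ∧ z' (j + 1) - z' j ≤ Real.sqrt D₂ := by
    intro j
    have hlo : Dp ≤ (z' (j + 1) - z' j) ^ 2 := by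
      rw [hsq j]
      have := (hincr j).1.1
      have h3 : D₁ ≤ (z (j + 1) - z j) ^ 2 := by
        have h4 := Real.sqrt_nonneg D₁
        nlinarith [Real.sq_sqrt hD₁0]
      linarith
    have hhi : (z' (j + 1) - z' j) ^ 2 ≤ D₂ := by
      rw [hsq j]
      have := (hincr j).1.2
      have h3 : (z (j + 1) - z j) ^ 2 ≤ D₂ := by
        have h4 := Real.sqrt_nonneg D₂
        have h5 := (hpos j).le
        nlinarith [Real.sq_sqrt hD₂0]
      linarith
    have hs : Real.sqrt ((z' (j + 1) - z' j) ^ 2) = z' (j + 1) - z' j := Real.sqrt_sq (hpos' j).le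
    exact ⟨by rw [← hs]; exact Real.sqrt_le_sqrt hlo, by rw [← hs]; exact Real.sqrt_le_sqrt hhi⟩
  have he₁' : ∀ j : ℤ, e₁ ≤ z' (j + 1) - z' j := fun j =>
    le_trans (Real.le_sqrt_of_sq_le he₁Dp) (hincr' j).1
  rw [ig_sq_height_eq z m m', ig_sq_height_eq z' m m', ← hk, ← hn]
  obtain ⟨hS1, hS2⟩ := ig_height_sq_bounds z (Real.sqrt_nonneg D₁) (fun j => (hincr j).1) n k
  rw [mul_pow, Real.sq_sqrt hD₁0] at hS1
  rw [mul_pow, Real.sq_sqrt hD₂0] at hS2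
  obtain ⟨hS1', -⟩ := ig_height_sq_bounds z' (Real.sqrt_nonneg Dp) hincr' n k
  rw [mul_pow, Real.sq_sqrt hDp0] at hS1'
  obtain ⟨hle, hgap⟩ := ig_vert_L z z' he₁ hθ0 (fun j => ⟨hpos j, (hincr j).2.2⟩) he₁' hsq n k
  have hS'0 : 0 ≤ z' (n + k) - z' n := by
    have := ig_height_lower z' he₁' n k
    have : (0 : ℝ) ≤ (k : ℝ) * e₁ := by positivity
    linarith
  have hd₂pos : 0 < d₂ := by
    have := (hincr 0).2.2
    have := hpos 0
    linarith
  refine ⟨by linarith, by linarith, by linarith, pow_le_pow_left₀ hS'0 hle 2, ?_⟩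
  have hk0 : (0 : ℝ) ≤ (k : ℝ) ^ 2 := by positivity
  have hβ' : β ≤ θ * e₁ / d₂ := by
    refine hβ.trans ?_
    rw [div_le_div_iff_of_pos_right hd₂pos]
    exact mul_le_mul_of_nonneg_right hθlo he₁.le
  calc β * (k : ℝ) ^ 2 ≤ θ * e₁ / d₂ * (k : ℝ) ^ 2 := mul_le_mul_of_nonneg_right hβ' hk0
    _ = (k : ℝ) ^ 2 * (θ * e₁ / d₂) := by ring
    _ ≤ _ := hgap

/-- **Far layers under the expansion, given the geometry.** [folklore] -/
theorem ig_far_diff_L {a H H' A₁ A₂ D₁ D₂ Dp β : ℝ} {k : ℕ} (δ : ℤ) (hA₁ : 0 < A₁) (h1 : A₁ ≤ a ^ 2)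
    (h2 : a ^ 2 ≤ A₂) (hh1 : (k : ℝ) ^ 2 * D₁ ≤ H ^ 2) (hh2 : H ^ 2 ≤ (k : ℝ) ^ 2 * D₂)
    (hh'1 : (k : ℝ) ^ 2 * Dp ≤ H' ^ 2) (hH' : H' ^ 2 ≤ H ^ 2) (hβ : β * (k : ℝ) ^ 2 ≤ H ^ 2 - H' ^ 2)
    (hβ0 : 0 ≤ β) (hone : 1 ≤ (k : ℝ) ^ 2 * Dp) (hDp : Dp ≤ D₁) :
    (∃ δ' : ℤ, (δ' = 0 ∨ δ' = 1) ∧ igFarSumL A₁ A₂ D₁ D₂ Dp β 6 k δ' ≤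
      layerInteraction lennardJones a H δ 1 - layerInteraction lennardJones (201 / 200 * a) H' δ 1) ∧
    -(401 / 40000 * A₂ / (2 * A₁ ^ 4) * (9 * (((k : ℝ) ^ 2 * D₁ / A₁)⁻¹) ^ 3 +
        32 / 7 * ((1 / 3 + (k : ℝ) ^ 2 * D₁ / A₁)⁻¹) ^ 2)) ≤
      layerInteraction lennardJones a H δ 1 - layerInteraction lennardJones (201 / 200 * a) H' δ 1 := by
  obtain ⟨δ', hδ', hred⟩ := ig_offset_reduce δ
  rw [hred, hred]
  have hβk : 0 ≤ β * (k : ℝ) ^ 2 := by positivity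
  have hh' : (k : ℝ) ^ 2 * Dp ≤ (k : ℝ) ^ 2 * D₁ := mul_le_mul_of_nonneg_left hDp (by positivity)
  refine ⟨⟨δ', hδ', ?_⟩, ?_⟩
  · unfold igFarSumL
    exact ig_layer_farL (N := 6) δ' hδ' hA₁ h1 h2 hh1 hh2 hh'1 hH' hβ hβk hone hh' (by norm_num)
  · exact ig_layer_genL δ' hδ' hA₁ h1 h2 hh1 hh2 hh'1 hH' hβ hβk hone hh'

/-- **Far layers of the expansion on the window `a ∈ [23 / 25, 191 / 200]`**: certified losses up to distance `7`,
generic decay `3 / 25 / k⁴` beyond. [folklore] -/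
theorem ig_far_bound_L1 {a : ℝ} (z z' : ℤ → ℝ) (s : ℤ → ℤ) (ha1 : 23 / 25 ≤ a) (ha2 : a ≤ 191 / 200)
    (hband : ∀ m : ℤ, (9 / 10 : ℝ) ^ 2 ≤ a ^ 2 / 3 + (z (m + 1) - z m) ^ 2 ∧
      a ^ 2 / 3 + (z (m + 1) - z m) ^ 2 ≤ (51 / 50 : ℝ) ^ 2)
    (hpos : ∀ m : ℤ, 0 < z (m + 1) - z m)
    (hz' : ∀ m : ℤ, (z' (m + 1) - z' m) ^ 2 = (z (m + 1) - z m) ^ 2 + a ^ 2 * (1 - (201 / 200 : ℝ) ^ 2) / 3)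
    (hpos' : ∀ m : ℤ, 0 < z' (m + 1) - z' m) (m m' : ℤ) (hk : 2 ≤ (m' - m).natAbs) :
    ((m' - m).natAbs ≤ 7 → -igEllL1 (m' - m).natAbs ≤
      layerInteraction lennardJones a (z m' - z m) (haggLabel s m' - haggLabel s m) 1 -
        layerInteraction lennardJones (201 / 200 * a) (z' m' - z' m) (haggLabel s m' - haggLabel s m) 1) ∧
    (8 ≤ (m' - m).natAbs → -((3 / 25 : ℝ) / ((m' - m).natAbs : ℝ) ^ 4) ≤
      layerInteraction lennardJones a (z m' - z m) (haggLabel s m' - haggLabel s m) 1 -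
        layerInteraction lennardJones (201 / 200 * a) (z' m' - z' m) (haggLabel s m' - haggLabel s m) 1) := by
  have h1 : (529 / 625 : ℝ) ≤ a ^ 2 := by nlinarith
  have h2 : a ^ 2 ≤ (36481 / 40000 : ℝ) := by nlinarith
  obtain ⟨g1, g2, g3, g4, g5⟩ := ig_far_geom_L (A₁ := 529 / 625) (A₂ := 36481 / 40000) (D₁ := 60719 / 120000) (D₂ := 5687 / 7500)
    (Dp := 502943 / 1000000) (d₂ := 2177 / 2500) (e₁ := 7091 / 10000) (β := 2303179 / 1000000000) z z' h1 h2 (by norm_num) (by norm_num)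
    (by norm_num) (by norm_num) (by norm_num) (by norm_num) (by norm_num) (by norm_num) (by norm_num) (by norm_num)
    (by norm_num) hband hpos hz' hpos' m m'
  set k := (m' - m).natAbs with hk'
  have hk2 : (2 : ℝ) ≤ (k : ℝ) := by exact_mod_cast hk
  have hone : (1 : ℝ) ≤ (k : ℝ) ^ 2 * (502943 / 1000000 : ℝ) := by nlinarith
  obtain ⟨⟨δ', hδ', hcert⟩, hgen⟩ := ig_far_diff_L (A₁ := 529 / 625) (A₂ := 36481 / 40000) (D₁ := 60719 / 120000) (D₂ := 5687 / 7500)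
    (Dp := 502943 / 1000000) (β := 2303179 / 1000000000) (haggLabel s m' - haggLabel s m) (by norm_num) h1 h2 g1 g2 g3 g4 g5
    (by norm_num) hone (by norm_num)
  constructor
  · intro hk7
    exact (ig_table_L1 k hk hk7 δ' hδ').trans hcert
  · intro hk8
    refine le_trans ?_ hgen
    have hk8' : (8 : ℝ) ≤ (k : ℝ) := by exact_mod_cast hk8
    have hdec := ig_generic_decay3 (c := (401 / 40000 : ℝ) * (36481 / 40000 : ℝ) / (2 * (529 / 625 : ℝ) ^ 4))
      (T := (60719 / 120000 : ℝ) / (529 / 625 : ℝ)) (by norm_num) (by norm_num) hk8'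
    have e2 : (k : ℝ) ^ 2 * (60719 / 120000 : ℝ) / (529 / 625 : ℝ) = (k : ℝ) ^ 2 * ((60719 / 120000 : ℝ) / (529 / 625 : ℝ)) := by ring
    rw [e2, neg_le_neg_iff]
    refine hdec.trans ?_
    have hk0 : (0 : ℝ) < (k : ℝ) := by linarith
    calc _ ≤ (3 / 25 : ℝ) * ((k : ℝ)⁻¹) ^ 4 := mul_le_mul_of_nonneg_right (by norm_num) (by positivity)
      _ = _ := by rw [inv_pow, ← div_eq_mul_inv]

/-! ## Adjacent layers and the in-plane layer -/

/-- **The two adjacent layers under the expansion.** [folklore] -/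
theorem ig_adj_bound_L {a A₁ A₂ : ℝ} (z z' : ℤ → ℝ) {s : ℤ → ℤ} (hs : IsHaggSeq s) (hA₁ : 1 / 2 ≤ A₁)
    (hA₁2 : A₁ ≤ 2) (h1 : A₁ ≤ a ^ 2) (h2 : a ^ 2 ≤ A₂)
    (hband : ∀ m : ℤ, (9 / 10 : ℝ) ^ 2 ≤ a ^ 2 / 3 + (z (m + 1) - z m) ^ 2 ∧
      a ^ 2 / 3 + (z (m + 1) - z m) ^ 2 ≤ (51 / 50 : ℝ) ^ 2)
    (hz' : ∀ m : ℤ, (z' (m + 1) - z' m) ^ 2 = (z (m + 1) - z m) ^ 2 + a ^ 2 * (1 - (201 / 200 : ℝ) ^ 2) / 3)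
    (m : ℤ) :
    igAdjSumL A₁ A₂ 6 ≤ layerInteraction lennardJones a (z (m + 1) - z m) (haggLabel s (m + 1) - haggLabel s m) 1 -
        layerInteraction lennardJones (201 / 200 * a) (z' (m + 1) - z' m) (haggLabel s (m + 1) - haggLabel s m) 1 ∧
      igAdjSumL A₁ A₂ 6 ≤ layerInteraction lennardJones a (z (m - 1) - z m) (haggLabel s (m - 1) - haggLabel s m) 1 -
        layerInteraction lennardJones (201 / 200 * a) (z' (m - 1) - z' m) (haggLabel s (m - 1) - haggLabel s m) 1 := by
  unfold igAdjSumL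
  constructor
  · rw [(ig_LI_adjacent hs a _ m).1, (ig_LI_adjacent hs (201 / 200 * a) _ m).1]
    have hb := hband m
    norm_num at hb
    exact ig_layer_adjL hA₁ hA₁2 h1 h2 (hz' m) (by linarith) (by linarith) (by norm_num)
  · rw [(ig_LI_adjacent hs a _ m).2, (ig_LI_adjacent hs (201 / 200 * a) _ m).2]
    have e1 : z (m - 1) - z m = -(z m - z (m - 1)) := by ring
    have e2 : z' (m - 1) - z' m = -(z' m - z' (m - 1)) := by ring
    rw [e1, e2, ig_LI_neg_height, ig_LI_neg_height]
    have hb := hband (m - 1)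
    have hzz := hz' (m - 1)
    rw [sub_add_cancel] at hb hzz
    norm_num at hb
    exact ig_layer_adjL hA₁ hA₁2 h1 h2 hzz (by linarith) (by linarith) (by norm_num)

/-- **The in-plane layer under the expansion**: six nearest neighbours at the worst spacing of the window plus the
certified (negative) rings. [folklore] -/
theorem ig_in_bound_L {a A₁ A₂ : ℝ} (hA₁ : 1 / 2 ≤ A₁) (h1 : A₁ ≤ a ^ 2) (h2 : a ^ 2 ≤ A₂) (hA₂ : A₂ ≤ 11 / 10) :
    6 * (igE A₂ - igE (40401 / 40000 * A₂)) + igInSumL A₁ A₂ 6 ≤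
      inLayerInteraction lennardJones a - inLayerInteraction lennardJones (201 / 200 * a) := by
  have h := ig_layer_inL hA₁ h1 h2 (N := 6) (by norm_num)
  have hcount := ig_cert_nncount6
  unfold igNNcount at hcount
  rw [hcount] at h
  unfold igInSumL
  have hmono := ig_nn_mono_L (by linarith : 0 < a ^ 2) h2 hA₂
  norm_num at h ⊢
  linarith

end Summit.AtomisticToContinuum.Crystallization.Theorems.CleanHull

end
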